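import Summits.HodgeConjecture.HodgeConjecture.Theorems.F0P2oLocalLettersHold            -- ★ `u1ThetaDichotomy_nonsplit_holds` (U1, hypothesis-free), over ★ `F0P2pGR91NOfN3` ∕ N3 ★ `F0P2oLineJacquetHolds`
import Summits.HodgeConjecture.HodgeConjecture.Theorems.F0P2pGR91NOfN3                 -- ★ road (T): `F0P2oU1LetterOfTower` (‹U1-DISJOINT› assembly), unique-sub CM head, N1 ★
import Summits.HodgeConjecture.HodgeConjecture.Theorems.F0P2oGR90Prop522OfLetters        -- ★ SC `GR90Prop522_of_letters (hN3) (hN6)` [GelbartRogawski1990 Prop. 5.2.2]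
import Summits.HodgeConjecture.HodgeConjecture.Theorems.F0P2oThetaClassOfSupercuspidal   -- ★ CLS `stubThetaClassOfSupercuspidal_holds`
import Summits.HodgeConjecture.HodgeConjecture.Theorems.F0P2oK1aWOfLetters               -- ★ `exists_forall_isThetaCenterChar` (a line-independent theta centre character)
import Summits.HodgeConjecture.HodgeConjecture.Theorems.F0P2oK1occ                       -- ★ GLUE-O `continuous_of_isThetaCenterChar`
import Summits.HodgeConjecture.HodgeConjecture.Theorems.F0P3cStCharTSNe                  -- ★ GLUE «Ne» `ne_comap_πn_of_isSupercuspidal` (LH6-p02)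
import Literature.NumberTheory.Automorphic.U3JacquetVanishingSupercuspidal               -- ★ N6 `Rogawski1990.u3_isSupercuspidal_iff_jacquet_eq_zero_holds`
import HarnessLib

/-!
# F0 · P3c · line LH10 «(D-b)ᵀ» — ORGAN (SCᴸ): THE SUPERCUSPIDAL THETA TYPE AT EVERY LINE OFF THE OCCURRING NORM CLASS, HYPOTHESIS-FREE

Cell `pub/hodgecm-mathlib`, crux H413 = `stmt-HodgeConjecture-24833` (lane `--supports`), route HCCMUnconditional; seat LH10-p01 (g0), organ OFFERED on the squad bus
`F0/P3c/STATUS.md` 2026-09-02 for the IN-HOUSE road of the LH10 skeleton's organ (O1) `stub_thetaLiftMember` «GLOBAL THETA MEMBER WITH PRESCRIBED NON-SPLIT CLASS»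
(LH10-plan (g0) skeleton v1 8dc0ca8b66eb155b; road: Θ-OCC-GEN ★ + weak approximation (WAᴸ, LH10-p02) + ★ S2♯-θ FILE 2 `F0P2uMemXiFamilyThetaNonsplit` «Case `X_v(μ, a, χ)`
SUPERCUSPIDAL»).  THEOREMS ONLY, sorry-free, no definition ∕ instance ∕ notation ∕ named fact.  HONEST LABEL: HC_CM is proved only modulo the printed citations (2 remaining
named inputs hLiu418 24832, h413 24833) until rung 0 closes; this file proves no printed statement BY ITSELF — it assembles ★ theorems of the tree (every print input it
touches — N3 #96, N6, U1 #97, N1, [GelbartRogawski1990 Prop. 5.2.2] — is a ★ THEOREM of the tree).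

THE MATHEMATICS.  Fix a CM field `L`, a real non-zero diagonal frame `dV` of rank 3 (reindexing `e₁`), a conjugate-symplectic `μ`, a continuous unitary character `χ_f` of
`U(1)(𝔸_{L⁺,f})` and a finite place `v` of `L⁺` NOT split in `L`.  Liu's local theta type `X_v(μ, a, χ_f)` (★ `xThetaCM … a v`) of the hermitian line `⟨a⟩`, `a ∈ (L⁺)ˣ`, is
SUPERCUSPIDAL iff the theta centre character `ψθ` (★ `IsThetaCenterChar`; one `ψθ` serves every line, ★ `exists_forall_isThetaCenterChar`) does NOT occur in the rank-one Weil
representation `ω¹_a` [GelbartRogawski1990 Prop. 5.2.2; GelbartRogawski1991 p. 467 L25–27] (★ `GR90Prop522_of_letters` over N3 ★ and N6 ★).  By the `(U(1), U(1))` theta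
dichotomy [HarrisKudlaSweet1996 Cor. 4.4; GelbartRogawski1991 Remark p. 466] `ψθ` occurs at SOME line `ε₀` (★ `u1Occurrence_exists` at the ★ U1 letter) and NOT at two lines in
different local norm classes (‹U1-DISJOINT›, ★ `u1Disjoint_of_letters` over N3 ★, ★ `exists_chi_isThetaCenterChar`, the ★ unique-sub head at N1 ★, ★ rank-3 line rigidity).
HENCE (§1 `exists_line_forall_isSupercuspidal_xThetaCM_of_not_isNorm`): there is a line `ε₀` such that for EVERY line `a` with `a ε₀⁻¹` NOT a local norm from `L_w` (the
non-norm currency of ★ `u1Disjoint_of_letters`, token for token) `X_v(μ, a, χ_f)` is supercuspidal — «`ω(γ_v, ψ′_v, χ_v)` for `ψ′_v` off the class of `ψ_v` is the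
supercuspidal member `πˢ(ϱ_v)`» [GelbartRogawski1991 §1.4 p. 451 L1–4; Lem. 5.1.2 proof p. 466].  §2 reads it on `U(H)(L⁺_v)` for a hermitian `H` framed by `(e₁, dV, g)`: such an
`a` carries a SUPERCUSPIDAL class `πs` of `U(H)(L⁺_v)` of theta type `X_v(μ, a, χ_f) ∘ κ_v⁻¹` (★ `ThetaTypeAtCM`; ★ CLS), distinct from the transported Keys label `πⁿ ∘ e` of any
(D-b)ᵀ binder tuple (★ «Ne»).  So the weak-approximation organ (WAᴸ) only has to put the GLOBAL line `a` of (O1) in the class `ε₀ · (non-norm)` at `v`.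

* §1 `exists_line_forall_isSupercuspidal_xThetaCM_of_not_isNorm` — ∃ ε₀, ∀ a, `a ε₀⁻¹ ∉ N(L_wˣ)` → `X_v(μ, a, χ_f)` supercuspidal.
* §2 `exists_line_forall_supercuspidal_thetaType_of_not_isNorm` — the `U(H)(L⁺_v)`-class reading (∃ πs supercuspidal ∧ theta type at `a`);
  `exists_line_forall_supercuspidal_thetaType_ne_of_not_isNorm` — the same with `πs ≠ πⁿ ∘ e` at every (D-b)ᵀ label tuple.

## References
* [GelbartRogawski1991] S. Gelbart, J. Rogawski, Invent. Math. 105 (1991): §1.4 pp. 450–451; Lem. 5.1.2 p. 466 (+ proof); Remark p. 466; §5.2 p. 467 L25–27.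
* [GelbartRogawski1990] S. Gelbart, J. Rogawski, Israel Math. Conf. Proc. 2 (1990): Prop. 5.2.2.
* [HarrisKudlaSweet1996] M. Harris, S. Kudla, W. J. Sweet, JAMS 9 (1996): Cor. 4.4.  [Rogawski1990] Ann. of Math. Stud. 123: §12.2 pp. 173–174; §13.1 p. 199.
-/

set_option autoImplicit false
-- the mandated namespace has the single-problem summit's repeated segment (`HodgeConjecture.HodgeConjecture`)
set_option linter.dupNamespace false

noncomputable section

open NumberField IsDedekindDomain MeasureTheory
open scoped Matrix

open Literature.NumberTheory Literature.NumberTheory.Automorphic Literature.NumberTheory.Automorphic.UnitaryGroup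
open Literature.NumberTheory.Automorphic.IdeleClassGroup
open Literature.NumberTheory.Automorphic.Liu2021 Literature.NumberTheory.Automorphic.Liu2021.Def411WeilCarriers
open Literature.NumberTheory.GaloisRepresentations
open Literature.NumberTheory.Rogawski1990
open Literature.NumberTheory.GelbartRogawski1991

namespace Summit.HodgeConjecture.HodgeConjecture.Cruxes.H413.F0P3cDbTSupercuspidalOffOccurringClass

variable (L : Type) [Field L] [NumberField L] [IsCMField L]

/-! ## §1 `X_v(μ, a, χ_f)` is supercuspidal at every line off the occurring norm class -/

set_option synthInstance.maxHeartbeats 400000 in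
set_option maxHeartbeats 8000000 in
/-- **‹U1-DISJOINT›, HYPOTHESIS-FREE** (road (T) «up the tower», all binders discharged in the tree): at a non-split `v`, a continuous character `ψ` of `E¹_v` does NOT occur
in both rank-one Weil representations `ω¹_{ε₁}`, `ω¹_{ε₂}` when `ε₂ ε₁⁻¹` is not a local norm.  ★ `u1Disjoint_of_letters` at N3 ★ `thetaType_nonsplit_jacquetModule_holds`, ★
`exists_chi_isThetaCenterChar`, the unique-sub CM head ★ `principalSeries_uniqueSub` at the hypothesis-free N1 ★, and ★ `exists_mul_conj_eq_ratio_of_areIsomorphicRep_xThetaCM`.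
[cite: HarrisKudlaSweet1996, Cor. 4.4] [cite: GelbartRogawski1991, Remark p. 466; §3.2 (3.2.1)–(3.2.2) p. 457] [cite: MoeglinVignerasWaldspurger1987, Chap. 3 §IV.4] -/
theorem u1Disjoint_holds :
    ∀ (L : Type) [Field L] [NumberField L] [IsCMField L] {n₀ : ℕ} (e₀ : Fin 1 × Fin 1 ≃ Fin n₀) (dL : Fin 1 → L)
      (hdL : ∀ i, IsCMField.complexConj L (dL i) = dL i) (hdL0 : ∀ i, dL i ≠ 0)
      (μ : Literature.NumberTheory.Automorphic.IdeleClassGroup L →ₜ* Circle) (hμ : IsConjugateSymplectic L μ)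
      (v : HeightOneSpectrum (𝓞 ↥(maximalRealSubfield L))), (∀ w : PlacesOver L v, IsCMField.complexConj L • w.1 = w.1) →
      ∀ (ψ : ↥(normOneUnits (conjLocal L (IsCMField.complexConj L) v)) →* ℂˣ), (Continuous fun β => ((ψ β : ℂˣ) : ℂ)) →
      ∀ (ε₁ ε₂ : (↥(maximalRealSubfield L))ˣ),
        (¬ ∃ x : (UnitaryGroup.LocalRing L v)ˣ, (x : UnitaryGroup.LocalRing L v) * conjLocal L (IsCMField.complexConj L) v x =
          algebraMap L (UnitaryGroup.LocalRing L v) (((ε₂ * ε₁⁻¹ : (↥(maximalRealSubfield L))ˣ) : ↥(maximalRealSubfield L)) : L)) →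
        ¬ (OccursInLineWeilCM L e₀ dL hdL hdL0 μ hμ ε₁ v ψ ∧ OccursInLineWeilCM L e₀ dL hdL hdL0 μ hμ ε₂ v ψ) :=
  F0P2oU1DisjointOfTower.u1Disjoint_of_letters F0P2oLineJacquetHolds.thetaType_nonsplit_jacquetModule_holds
    F0P2oThetaCenterCharGlobalise.exists_chi_isThetaCenterChar
    (F0P2pPrincipalSeriesUniqueSubCM.principalSeries_uniqueSub fun L _ _ _ =>
      F0P3U3PrincipalSeriesJacquetFiltrationHolds.U3PrincipalSeriesJacquetFiltration_holds_of_lineAction L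
        (F0P3U3PrincipalSeriesOpenCellTorusChar.torus_normalizedJacquet_openCellLine_eq_weylChar L))
    F0P2oXThetaLineRigidity.exists_mul_conj_eq_ratio_of_areIsomorphicRep_xThetaCM

set_option synthInstance.maxHeartbeats 400000 in
set_option maxHeartbeats 8000000 in
/-- **ORGAN (SCᴸ) §1 — `X_v(μ, a, χ_f)` IS SUPERCUSPIDAL AT EVERY LINE OFF THE OCCURRING NORM CLASS, hypothesis-free.**  For a CM field `L`, a real non-zero diagonal
frame `dV` (reindexing `e₁`), `μ` conjugate-symplectic, `χ_f` continuous unitary and a finite place `v` of `L⁺` NOT split in `L`, there is a line `ε₀ ∈ (L⁺)ˣ` (a line at which the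
theta centre character occurs in `ω¹_{ε₀}`, ★ U1) such that for EVERY line `a ∈ (L⁺)ˣ` with `a ε₀⁻¹` NOT a local norm (`¬ ∃ x ∈ (L ⊗ L⁺_v)ˣ, x · x̄ = a ε₀⁻¹`), Liu's local
theta type `X_v(μ, a, χ_f)` (★ `xThetaCM … a v`) is SUPERCUSPIDAL: ‹U1-DISJOINT› forbids occurrence at `a`, and [GelbartRogawski1990 Prop. 5.2.2] (★ `GR90Prop522_of_letters` at
N3 ★, N6 ★) turns non-occurrence into supercuspidality. [cite: GelbartRogawski1991, §1.4 p. 451 L1–4; Lem. 5.1.2 p. 466; §5.2 p. 467 L25–27]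
[cite: GelbartRogawski1990, Prop. 5.2.2] [cite: HarrisKudlaSweet1996, Cor. 4.4] -/
theorem exists_line_forall_isSupercuspidal_xThetaCM_of_not_isNorm
    {n' : ℕ} (e₁ : Fin 3 × Fin 1 ≃ Fin n') (dV : Fin 3 → L) (hdV : ∀ i, IsCMField.complexConj L (dV i) = dV i) (hdV0 : ∀ i, dV i ≠ 0)
    (μ : Literature.NumberTheory.Automorphic.IdeleClassGroup L →ₜ* Circle) (hμ : IsConjugateSymplectic L μ)
    (χf : UnitaryGroup.finAdelicOne (↥(maximalRealSubfield L)) L (IsCMField.complexConj L) →* ℂˣ)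
    (hcont : Continuous χf) (hunit : ∀ z, ‖((χf z : ℂˣ) : ℂ)‖ = 1)
    (v : HeightOneSpectrum (𝓞 ↥(maximalRealSubfield L))) (hv : ∀ w : PlacesOver L v, IsCMField.complexConj L • w.1 = w.1) :
    ∃ ε₀ : (↥(maximalRealSubfield L))ˣ, ∀ a : (↥(maximalRealSubfield L))ˣ,
      (¬ ∃ x : (UnitaryGroup.LocalRing L v)ˣ, (x : UnitaryGroup.LocalRing L v) * conjLocal L (IsCMField.complexConj L) v x =
          algebraMap L (UnitaryGroup.LocalRing L v) (((a * ε₀⁻¹ : (↥(maximalRealSubfield L))ˣ) : ↥(maximalRealSubfield L)) : L)) →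
      (xThetaCM L e₁ dV hdV hdV0 μ hμ χf a v).IsSupercuspidal := by
  -- one theta centre character for every line, continuous
  obtain ⟨ψθ, hψθ⟩ := F0P2oK1aWOfLetters.exists_forall_isThetaCenterChar L μ χf v
  have hψc : Continuous fun β => ((ψθ β : ℂˣ) : ℂ) := F0P2oK1occ.continuous_of_isThetaCenterChar L μ χf hcont 1 v ψθ (hψθ 1)
  -- the occurring line (U1 ★), on the Witt kernel line `⟨kernelLineCM dV⟩` of the frame
  obtain ⟨ε₀, hocc⟩ := u1Occurrence_exists F0P2oLocalLettersHold.u1ThetaDichotomy_nonsplit_holds L (Equiv.prodUnique (Fin 1) (Fin 1))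
    (kernelLineCM dV) (complexConj_kernelLineCM dV hdV) (kernelLineCM_ne_zero dV hdV0) μ hμ v hv ψθ hψc
  refine ⟨ε₀, fun a hna => ?_⟩
  -- ‹U1-DISJOINT›: no occurrence at `a`
  have hnocc : ¬ OccursInLineWeilCM L (Equiv.prodUnique (Fin 1) (Fin 1)) (kernelLineCM dV) (complexConj_kernelLineCM dV hdV)
      (kernelLineCM_ne_zero dV hdV0) μ hμ a v ψθ :=
    fun h => u1Disjoint_holds L (Equiv.prodUnique (Fin 1) (Fin 1)) (kernelLineCM dV) (complexConj_kernelLineCM dV hdV) (kernelLineCM_ne_zero dV hdV0)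
      μ hμ v hv ψθ hψc ε₀ a hna ⟨hocc, h⟩
  -- [GR90 Prop. 5.2.2]: non-occurrence ⟺ supercuspidal
  exact (F0P2oGR90Prop522OfLetters.GR90Prop522_of_letters F0P2oLineJacquetHolds.thetaType_nonsplit_jacquetModule_holds
    Literature.NumberTheory.Rogawski1990.u3_isSupercuspidal_iff_jacquet_eq_zero_holds L e₁ dV hdV hdV0 (Equiv.prodUnique (Fin 1) (Fin 1)) μ hμ χf hcont hunit
    v hv a ψθ (hψθ a)).2 hnocc

/-! ## §2 Read on `U(H)(L⁺_v)`: a supercuspidal theta-type class at every such line, distinct from `πⁿ ∘ e` -/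

set_option synthInstance.maxHeartbeats 400000 in
set_option maxHeartbeats 8000000 in
/-- **ORGAN (SCᴸ) §2 — THE SUPERCUSPIDAL THETA CLASS ON `U(H)(L⁺_v)` AT EVERY LINE OFF THE OCCURRING CLASS.**  For a hermitian `H` with unit determinant framed by `(e₁, dV, g)`
and data as in §1: there is a line `ε₀` such that every line `a` with `a ε₀⁻¹` not a local norm at `v` carries a SUPERCUSPIDAL class `πs` of `U(H)(L⁺_v)` which IS the local theta
type `X_v(μ, a, χ_f) ∘ κ_v⁻¹` (★ `ThetaTypeAtCM`) — §1 + ★ CLS `stubThetaClassOfSupercuspidal_holds`.  (The target of (O1)'s «ALL v-constituents are supercuspidal of theta type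
`X_v(μ, ε, χ_f) ∘ κ_v⁻¹`» once the weak-approximation organ puts the global line in this class.) [cite: GelbartRogawski1991, §1.4 p. 451 L1–4; Lem. 5.1.2 p. 466]
[cite: GelbartRogawski1990, Prop. 5.2.2] -/
theorem exists_line_forall_supercuspidal_thetaType_of_not_isNorm (H : Matrix (Fin 3) (Fin 3) L) (hH : (H.map (cmConjRingHom L))ᵀ = H) (hHd : IsUnit H.det)
    {n' : ℕ} (e₁ : Fin 3 × Fin 1 ≃ Fin n') (dV : Fin 3 → L) (hdV : ∀ i, IsCMField.complexConj L (dV i) = dV i) (hdV0 : ∀ i, dV i ≠ 0) (g : GL (Fin 3) L)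
    (hg : ((g : Matrix (Fin 3) (Fin 3) L).map (cmConjRingHom L))ᵀ * H * (g : Matrix (Fin 3) (Fin 3) L) = Matrix.diagonal dV)
    (μ : Literature.NumberTheory.Automorphic.IdeleClassGroup L →ₜ* Circle) (hμ : IsConjugateSymplectic L μ)
    (χf : UnitaryGroup.finAdelicOne (↥(maximalRealSubfield L)) L (IsCMField.complexConj L) →* ℂˣ)
    (hcont : Continuous χf) (hunit : ∀ z, ‖((χf z : ℂˣ) : ℂ)‖ = 1)
    (v : HeightOneSpectrum (𝓞 ↥(maximalRealSubfield L))) (hv : ∀ w : PlacesOver L v, IsCMField.complexConj L • w.1 = w.1) :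
    ∃ ε₀ : (↥(maximalRealSubfield L))ˣ, ∀ a : (↥(maximalRealSubfield L))ˣ,
      (¬ ∃ x : (UnitaryGroup.LocalRing L v)ˣ, (x : UnitaryGroup.LocalRing L v) * conjLocal L (IsCMField.complexConj L) v x =
          algebraMap L (UnitaryGroup.LocalRing L v) (((a * ε₀⁻¹ : (↥(maximalRealSubfield L))ˣ) : ↥(maximalRealSubfield L)) : L)) →
      ∃ πs : IrrClass ((cmDatum L 3 H).Local v), πs.IsSupercuspidal ∧ ThetaTypeAtCM L H e₁ dV hdV hdV0 g hg μ hμ χf a v πs := by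
  obtain ⟨ε₀, hε₀⟩ := exists_line_forall_isSupercuspidal_xThetaCM_of_not_isNorm L e₁ dV hdV hdV0 μ hμ χf hcont hunit v hv
  exact ⟨ε₀, fun a hna => F0P2oThetaClassOfSupercuspidal.stubThetaClassOfSupercuspidal_holds L H hH hHd e₁ dV hdV hdV0 g hg μ hμ χf hcont hunit
    v hv a (hε₀ a hna)⟩

set_option synthInstance.maxHeartbeats 400000 in
set_option maxHeartbeats 8000000 in
/-- **ORGAN (SCᴸ) §2, AT THE (D-b)ᵀ LABEL** — the same class is moreover DISTINCT from the transported Keys label `πⁿ ∘ e` of every (D-b)ᵀ binder tuple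
`(T, a′, ha, h; π², πⁿ)` (★ «Ne» `F0P3cStCharTSNe.ne_comap_πn_of_isSupercuspidal`: a supercuspidal class is no constituent of `i_G(χ_ξ)`), for ANY torus characters
`(μ₁, η₁, η₂)` labelling the pair. [cite: GelbartRogawski1991, §1.4 p. 451 L1–4; Lem. 5.1.2 p. 466] [cite: Rogawski1990, §12.2 pp. 173–174; §13.1 Prop. 13.1.3 (d) p. 199] -/
theorem exists_line_forall_supercuspidal_thetaType_ne_of_not_isNorm (H : Matrix (Fin 3) (Fin 3) L) (hH : (H.map (cmConjRingHom L))ᵀ = H) (hHd : IsUnit H.det)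
    {n' : ℕ} (e₁ : Fin 3 × Fin 1 ≃ Fin n') (dV : Fin 3 → L) (hdV : ∀ i, IsCMField.complexConj L (dV i) = dV i) (hdV0 : ∀ i, dV i ≠ 0) (g : GL (Fin 3) L)
    (hg : ((g : Matrix (Fin 3) (Fin 3) L).map (cmConjRingHom L))ᵀ * H * (g : Matrix (Fin 3) (Fin 3) L) = Matrix.diagonal dV)
    (μ : Literature.NumberTheory.Automorphic.IdeleClassGroup L →ₜ* Circle) (hμ : IsConjugateSymplectic L μ)
    (χf : UnitaryGroup.finAdelicOne (↥(maximalRealSubfield L)) L (IsCMField.complexConj L) →* ℂˣ)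
    (hcont : Continuous χf) (hunit : ∀ z, ‖((χf z : ℂˣ) : ℂ)‖ = 1)
    (v : HeightOneSpectrum (𝓞 ↥(maximalRealSubfield L))) (hv : ∀ w : PlacesOver L v, IsCMField.complexConj L • w.1 = w.1) :
    ∃ ε₀ : (↥(maximalRealSubfield L))ˣ, ∀ a : (↥(maximalRealSubfield L))ˣ,
      (¬ ∃ x : (UnitaryGroup.LocalRing L v)ˣ, (x : UnitaryGroup.LocalRing L v) * conjLocal L (IsCMField.complexConj L) v x =
          algebraMap L (UnitaryGroup.LocalRing L v) (((a * ε₀⁻¹ : (↥(maximalRealSubfield L))ˣ) : ↥(maximalRealSubfield L)) : L)) →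
      ∃ πs : IrrClass ((cmDatum L 3 H).Local v), πs.IsSupercuspidal ∧ ThetaTypeAtCM L H e₁ dV hdV hdV0 g hg μ hμ χf a v πs ∧
        ∀ (T : GL (Fin 3) (UnitaryGroup.LocalRing L v)) (a' : UnitaryGroup.LocalRing L v) (ha : IsUnit a')
          (h : formCongr (conjLocal L (IsCMField.complexConj L) v) T (H.map (algebraMap L (UnitaryGroup.LocalRing L v))) =
            a' • (Matrix.of fun i j : Fin 3 => if i.val + j.val + 1 = 3 then (1 : L) else 0).map (algebraMap L (UnitaryGroup.LocalRing L v)))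
          (μ₁ : (UnitaryGroup.LocalRing L v)ˣ →* ℂˣ) (η₁ η₂ : ↥(normOneUnits (conjLocal L (IsCMField.complexConj L) v)) →* ℂˣ)
          (π2 πn : IrrClass (Gqs L v)), KeysCaseTwoLabels L v μ₁ η₁ η₂ π2 πn →
          πs ≠ IrrClass.comap (cmDatumLocalCongr L v T ha h).symm πn := by
  obtain ⟨ε₀, hε₀⟩ := exists_line_forall_supercuspidal_thetaType_of_not_isNorm L H hH hHd e₁ dV hdV hdV0 g hg μ hμ χf hcont hunit v hv
  refine ⟨ε₀, fun a hna => ?_⟩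
  obtain ⟨πs, hsc, hθ⟩ := hε₀ a hna
  exact ⟨πs, hsc, hθ, fun T a' ha h μ₁ η₁ η₂ π2 πn hK =>
    F0P3cStCharTSNe.ne_comap_πn_of_isSupercuspidal L H v hv T a' ha h μ₁ η₁ η₂ π2 πn hK πs hsc⟩

end Summit.HodgeConjecture.HodgeConjecture.Cruxes.H413.F0P3cDbTSupercuspidalOffOccurringClass

end
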